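import Summits.QuantumFields.BalabanUV.T4Continuum.Support.NE3EnergyRateWSupOfChart
import Summits.QuantumFields.BalabanUV.T4Continuum.Support.NE3SlicePoincareShape
import Summits.QuantumFields.BalabanUV.T4Continuum.Support.NE3FrameFreeSliceW
import Summits.QuantumFields.BalabanUV.T4Continuum.Support.NE3CurlPairedResidualScale
import HarnessLib

/-!
# T⁴ programme, node NE3 — «THE K6 JUNCTION»: the chart's `coer` leaf ((ML_w) along the path) DISCHARGED FROM THE SLICE
# POINCARÉ SHAPE (P♮)_W AT THE BACKGROUND, and the re-typed root T-E_w♯ from a `coer`-FREE chart + `SlicePoincare` BY NAME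

NE3 (node U1b), row NE3 OWNER `b2b-balaban-t4-ne3-p1` (gen 24), INTENT journal l.20388.  Route H♮ (ρ-g22-2, blueprint ρ-g23-3)
delivers, background by background, the ONE located analytic leaf of the local half of NE3 at a curved background,
`NE3SlicePoincareShape.SlicePoincare L k W (frameFreeBlockLandauW L N k W) C F` (rows K0–K6 of the crew).  The consumer of
record is the chart composition (64S) `NE3EnergyRateWSupOfChart.ne3EnergyRateWSup_of_chartLeaves`, whose hypothesis structure
`NE3EnergyChartLeaves.ChartLeaves` carries the tangent coercivity of the Wilson Hessian along the chart's path as the FIELD `coer`.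
THIS FILE removes that field from the hypotheses:

* §1 `ChartPath 𝒞 L N k V U_A U_B u Γ Ψ Ψ′ T Nrm θ κ θ₀ a` — `ChartLeaves` VERBATIM MINUS `coer` (L1 REP, the L2 path data, the
  L7 radius ∕ acceleration bound), and `chartLeaves_of_chartPath` (a `ChartPath` plus a `coer` clause IS a `ChartLeaves`);
* §2 **`coer_of_slicePoincare`** — at a unitary background `W`, on a set `T` of skew `(N·L^k)`-periodic directions,
  `SlicePoincare L k W T CP (periodBox (N·L^k))`, a skew path `Γ` with `‖Γ t x μ‖ ≤ α` and plaquette radius `a` of `W·e^{Γ t}` on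
  the period window, and the two displayed smallnesses of `NE3SlicePoincareShape.weightedTangentCoercive_vary_of_slicePoincare`
  give the `coer` clause `∀ t ∈ [0,1], ∀ Y ∈ T, c♮·energyNormW L k W Y (periodBox (N·L^k))² ≤ hess (W·e^{Γ t}) Y Y (perWin d (N·L^k))`
  with `c♮ = (1∕(2·card n·(1+4CP)))∕(2 + 24√d(e^α−1)L^k)²` (p228175 ∘ `NE3EnergyChartLeavesSockets.coer_of_weightedTangentCoercive_vary`,
  time by time), and `coer_of_slicePoincare_lambda` — the Λ-UNIFORM constant `cΛ = (1∕(2·card n·(1+4CP)))∕(1+√Λ)²` under the chart's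
  level datum `(1 + 24√d(e^α−1)L^k)² + 48·d·a·(L^k)² ≤ Λ`;
* §3 **`ne3EnergyRateWSup_of_slicePoincare`** (class-generic) — EXACTLY (64S) with `hchart`'s `ChartLeaves … c …` REPLACED by
  `ChartPath … (frameFreeBlockLandauW L N k (cavg L U_B)) (energyNormW L k (cavg L U_B) · (periodBox (N·L^k))) …`
  ∧ `SlicePoincare L k (cavg L U_B) (frameFreeBlockLandauW L N k (cavg L U_B)) CP (periodBox (N·L^k))` ∧ `112·d·a·CP·(L^k)² ≤ 1∕(2·card n)`
  per pair, uniform `CP ≥ 0`, `CP·(√Λ−1)² ≤ 1∕4`, budget `2Λθ + Λθ² + κ ≤ cΛ∕2` ⟹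
  `NE3EnergyRateWSup d 𝒞 L N b g ((1+θ₀)·(2∕cΛ)·C′) ((√Λ−1)∕(24√d)) dom`;
* §4 **`ne3EnergyRateWSup_sfClass_of_slicePoincare`** — the `sfClass` specialisation with (RES♯) DISCHARGED BY NAME on `T_♮(W)`
  (`NE3CurlPairedResidualScale.curlPairedResidual_regular_residualScale`; `T_♮(W) ⊆ {skew, periodic, TangentIter L (k−1) (cavg L U_B)}` by
  K0b's definition) and the background's unitarity by `NE3EnergyChartLeaves.isUnitaryCfg_cavg_of_regular`.

SO THAT, the moment the crew's K6c concludes `SlicePoincare L k W (frameFreeBlockLandauW L N k W) C (periodBox …)` for the chart's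
backgrounds, (ML_w) DISAPPEARS from the END's hypotheses: T-E_w♯ (hence `NE3Shape` over the class via (63S)∕(55S)) ⇐ (H∃) ∧ regime ∧
chart L1∕L2 (`ChartPath`, B11 Prop. 2∕3 TYPE — a hypothesis shape asserted for nothing) ∧ level data `(α_k, a_k; Λ)`.

HONEST FRAMING.  Kernel bookkeeping ([folklore]; ONE hypothesis structure, 0 sorry); NOTHING about Bałaban's minimisers is
asserted; (P♮)_W at `W = cavg L U_B` is a HYPOTHESIS here (route H♮'s K6c is not yet in the tree at this writing); `ChartPath`,
(H∃), the level data remain hypotheses; T-E_w♯ and **NE3 are NOT proved**; spine PROVED 0∕9; finite T⁴ rung (B)+1 — NOT infinite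
volume, NOT mass gap, NOT `BetaPertH`, NOT Clay.  ABSOLUTE RULE kept: no printed sentence is a hypothesis (context only:
[Balaban1985Variational] Prop. 2 p. 281, Prop. 3 p. 289; [Balaban1985PropagatorsII] Thm 3.3 (3.46)).  PLACEMENT:
`Summits/QuantumFields/BalabanUV/`; imports accepted modules only.  HONEST DEPENDENCY (cell page 1): continuum YM on T⁴ ⇐
BetaPertH ∧ nine spine estimates (0/9 proved); BetaPertH ⇐ (D1) ∧ (D4) ∧ CAP+tail; G-an2-4 gates asym, D1 and NE2/3/4.
-/

set_option autoImplicit false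

open scoped BigOperators Matrix.Norms.L2Operator
open NormedSpace Finset

namespace Summit.QuantumFields.BalabanUV.T4Continuum.NE3EnergyRateWSupOfSlicePoincare

open Set
open Literature.MathematicalPhysics.QuantumFieldTheory.Balaban1983to89
open B7Prop1Explicit B7Prop2Explicit
open T4AveragingDeficitWall hiding Site Plane Plaq Bond
open T4AveragingDeficitWallBoundary (periodBox)
open AveragingDeficitPeriodicCounting (IsPeriodicDir)
open AveragingDeficitChartCalculus (cavg)
open AveragingDeficitMultiLevelPrep (LevelSmall TangentIter tower)
open MinimalActionLevels (perWin)
open MinimalActionSandwich (IsMinimiser admissible)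
open MinimalActionRate (Regular sfClass)
open NE3EnergyShapes (residualScale residualScale_nonneg IsUnitarySite IsPeriodicSite)
open NE3HessForm (hess)
open NE3HessShapes (plaqsOf)
open NE3EnergyChartLeaves (ChartLeaves isUnitaryCfg_cavg_of_regular)
open NE3EnergyWeightedShapes (energyNormW energyNormW_nonneg CurlPairedResidual WeightedTangentCoercive)
open NE3EnergyWeightedSupShape (NE3EnergyRateWSup)
open NE3EnergyChartLeavesSockets (coer_of_weightedTangentCoercive_vary)
open NE3EnergyRateWSupOfChart (ne3EnergyRateWSup_of_chartLeaves)
open NE3SlicePoincareShape (SlicePoincare weightedTangentCoercive_vary_of_slicePoincare)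
open NE3FrameFreeSliceW (frameFreeBlockLandauW)
open NE3CurlPairedResidualScale (curlPairedResidual_regular_residualScale)

noncomputable section

variable {d : ℕ} {n : Type*} [Fintype n] [DecidableEq n]

/-! ## §1 The `coer`-free chart at one pair -/

/-- **THE `coer`-FREE CHART AT ONE PAIR** `(U_A, U_B)`: `NE3EnergyChartLeaves.ChartLeaves` VERBATIM WITHOUT the field `coer` (and
without its constant `c`).  FIELDS: L1 REP (`gauge`, `rep`); the chart path L2 (`endW`, `skew`, `per`, `vel`, `acc`, `skewEnd`, `skewAcc`,
`adm`, `tangent`, `perT`, `velocity`, `close`); the radius and acceleration bound (`small`, `accel`).  A hypothesis SHAPE (B11 Prop. 2∕3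
TYPE in the tree's objects), asserted for no configuration of Bałaban's. [folklore] -/
@[folklore]
structure ChartPath (𝒞 : ℕ → Set (Site d → Fin d → (Matrix n n ℂ)ˣ)) (L N k : ℕ)
    (V UA UB : Site d → Fin d → (Matrix n n ℂ)ˣ) (u : Site d → (Matrix n n ℂ)ˣ)
    (Γ Ψ Ψ' : ℝ → Site d → Fin d → Matrix n n ℂ) (T : Set (Site d → Fin d → Matrix n n ℂ))
    (Nrm : (Site d → Fin d → Matrix n n ℂ) → ℝ) (θ κ θ₀ a : ℝ) : Prop where
  /-- L1 REP: the gauge transformation is `U(N)`-valued and periodic -/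
  gauge : IsUnitarySite u ∧ IsPeriodicSite u ((N * L ^ k : ℕ) : ℤ)
  /-- L1 REP: `U_A^u = W·exp Γ(0)` -/
  rep : gaugeAct u UA = vary (cavg L UB) (Γ 0) 1
  /-- L2: the path ends at the background: `Γ 1 = 0` -/
  endW : Γ 1 = 0
  /-- L2: the path fields are `𝔲(N)`-valued at all times -/
  skew : ∀ t, IsSkewDir (Γ t)
  /-- L2: the path fields are periodic at all times -/
  per : ∀ t, IsPeriodicDir (Γ t) ((N * L ^ k : ℕ) : ℤ)
  /-- L2∕L3: `Ψ t` is the bondwise right-logarithmic velocity of the path on `[0,1]` -/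
  vel : ∀ t ∈ Icc (0:ℝ) 1, ∀ (y : Site d) (μ : Fin d),
    HasDerivAt (fun s => exp (Γ s y μ)) (exp (Γ t y μ) * Ψ t y μ) t
  /-- L2∕L3: `Ψ′ t` is the bondwise derivative of the velocity on `[0,1]` -/
  acc : ∀ t ∈ Icc (0:ℝ) 1, ∀ (y : Site d) (μ : Fin d), HasDerivAt (fun s => Ψ s y μ) (Ψ' t y μ) t
  /-- L2: the tangent datum `X := Ψ 1` is `𝔲(N)`-valued -/
  skewEnd : IsSkewDir (Ψ 1)
  /-- L2: the accelerations are `𝔲(N)`-valued on `[0,1]` -/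
  skewAcc : ∀ t ∈ Icc (0:ℝ) 1, IsSkewDir (Ψ' t)
  /-- L2 (a): the path stays in run A's fibre and class -/
  adm : ∀ t ∈ Icc (0:ℝ) 1, vary (cavg L UB) (Γ t) 1 ∈ admissible 𝒞 L k V
  /-- L2: the tangent datum lies in the tangent space -/
  tangent : Ψ 1 ∈ T
  /-- the tangent space consists of periodic directions -/
  perT : ∀ Y ∈ T, IsPeriodicDir Y ((N * L ^ k : ℕ) : ℤ)
  /-- L2 (b): the non-tangent part of the velocity is `θ`-small in the norm `Nrm` -/
  velocity : ∀ t ∈ Icc (0:ℝ) 1, Nrm (Ψ t - Ψ 1) ≤ θ * Nrm (Ψ 1)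
  /-- L2 (b): the start of the path is `(1+θ₀)`-close to the tangent datum in the norm `Nrm` -/
  close : Nrm (Γ 0) ≤ (1 + θ₀) * Nrm (Ψ 1)
  /-- L2∕L7: a plaquette radius of the moving configuration on the period window -/
  small : ∀ t ∈ Icc (0:ℝ) 1, ∀ p ∈ perWin d (N * L ^ k),
    ‖((fhol (vary (cavg L UB) (Γ t) 1) p : (Matrix n n ℂ)ˣ) : Matrix n n ℂ) - 1‖ ≤ a
  /-- L7 × L2 (b): the acceleration bound of the chart, in the norm `Nrm` -/
  accel : ∀ t ∈ Icc (0:ℝ) 1, a * ∑ p ∈ perWin d (N * L ^ k), ‖curl (vary (cavg L UB) (Γ t) 1) (Ψ' t) p‖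
    ≤ κ * Nrm (Ψ 1) ^ 2

/-- **A `coer`-FREE CHART PLUS A `coer` CLAUSE IS A CHART**: `ChartPath … θ κ θ₀ a` and
`∀ t ∈ [0,1], ∀ Y ∈ T, c·Nrm Y² ≤ hess (W·e^{Γ t}) Y Y (perWin d (N·L^k))` give `ChartLeaves … c θ κ θ₀ a`. [folklore] -/
theorem chartLeaves_of_chartPath {𝒞 : ℕ → Set (Site d → Fin d → (Matrix n n ℂ)ˣ)} {L N k : ℕ}
    {V UA UB : Site d → Fin d → (Matrix n n ℂ)ˣ} {u : Site d → (Matrix n n ℂ)ˣ}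
    {Γ Ψ Ψ' : ℝ → Site d → Fin d → Matrix n n ℂ} {T : Set (Site d → Fin d → Matrix n n ℂ)}
    {Nrm : (Site d → Fin d → Matrix n n ℂ) → ℝ} {c θ κ θ₀ a : ℝ}
    (h : ChartPath 𝒞 L N k V UA UB u Γ Ψ Ψ' T Nrm θ κ θ₀ a)
    (hcoer : ∀ t ∈ Icc (0:ℝ) 1, ∀ Y ∈ T, c * Nrm Y ^ 2 ≤ hess (vary (cavg L UB) (Γ t) 1) Y Y (perWin d (N * L ^ k))) :
    ChartLeaves 𝒞 L N k V UA UB u Γ Ψ Ψ' T Nrm c θ κ θ₀ a where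
  gauge := h.gauge
  rep := h.rep
  endW := h.endW
  skew := h.skew
  per := h.per
  vel := h.vel
  acc := h.acc
  skewEnd := h.skewEnd
  skewAcc := h.skewAcc
  adm := h.adm
  tangent := h.tangent
  perT := h.perT
  velocity := h.velocity
  close := h.close
  coer := hcoer
  small := h.small
  accel := h.accel

/-! ## §2 The `coer` clause from the slice Poincaré shape at the background -/

/-- **`coer` FROM (P♮)_W, TIME BY TIME.**  At a unitary background `W` (`L ≥ 1`, `M := N·L^k ≥ 1`), for a set `T` of skew
`M`-periodic directions with `SlicePoincare L k W T CP (periodBox M)` (`0 ≤ CP`), a path `Γ` of skew directions with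
`‖Γ t x μ‖ ≤ α` (`0 ≤ α`) whose moving configurations `W·e^{Γ t}` have plaquette radius `a ≥ 0` on the period window for
`t ∈ [0,1]`, under `CP·(24√d(e^α−1)L^k)² ≤ 1∕4` and `112·d·a·CP·(L^k)² ≤ 1∕(2·card n)`:
`∀ t ∈ [0,1], ∀ Y ∈ T, c♮·energyNormW L k W Y (periodBox M)² ≤ hess (W·e^{Γ t}) Y Y (perWin d M)` with
`c♮ = (1∕(2·card n·(1+4CP)))∕(2 + 24√d(e^α−1)L^k)²` — (ML_w) at the moving configuration by
`NE3SlicePoincareShape.weightedTangentCoercive_vary_of_slicePoincare`, read in the fixed norm at `W` by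
`NE3EnergyChartLeavesSockets.coer_of_weightedTangentCoercive_vary`. [folklore] -/
theorem coer_of_slicePoincare [Nonempty n] {L : ℕ} (hL : 1 ≤ L) (k : ℕ) {M : ℕ} (hM : 1 ≤ M)
    {W : Site d → Fin d → (Matrix n n ℂ)ˣ} (hW : IsUnitaryCfg W)
    {T : Set (Site d → Fin d → Matrix n n ℂ)} (hskewT : ∀ Y ∈ T, IsSkewDir Y) (hperT : ∀ Y ∈ T, IsPeriodicDir Y (M : ℤ))
    {CP : ℝ} (hCP : 0 ≤ CP) (hP : SlicePoincare L k W T CP (periodBox M))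
    {Γ : ℝ → Site d → Fin d → Matrix n n ℂ} (hskew : ∀ t, IsSkewDir (Γ t))
    {α : ℝ} (hα : 0 ≤ α) (hΓα : ∀ t (x : Site d) (μ : Fin d), ‖Γ t x μ‖ ≤ α)
    {a : ℝ} (ha : 0 ≤ a)
    (hsmall : ∀ t ∈ Icc (0:ℝ) 1, ∀ p ∈ perWin d M, ‖((fhol (vary W (Γ t) 1) p : (Matrix n n ℂ)ˣ) : Matrix n n ℂ) - 1‖ ≤ a)
    (hreg₁ : CP * (24 * Real.sqrt d * (Real.exp α - 1) * (L : ℝ) ^ k) ^ 2 ≤ 1 / 4)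
    (hreg₂ : 112 * (d : ℝ) * a * CP * ((L : ℝ) ^ k) ^ 2 ≤ 1 / (2 * (Fintype.card n : ℝ))) :
    ∀ t ∈ Icc (0:ℝ) 1, ∀ Y ∈ T,
      (1 / (2 * (Fintype.card n : ℝ) * (1 + 4 * CP))) / (2 + 24 * Real.sqrt d * (Real.exp α - 1) * (L : ℝ) ^ k) ^ 2
          * energyNormW L k W Y (periodBox M) ^ 2
        ≤ hess (vary W (Γ t) 1) Y Y (perWin d M) := by
  intro t ht Y hY
  have hML : WeightedTangentCoercive L k (vary W (Γ t) 1) T (1 / (2 * (Fintype.card n : ℝ) * (1 + 4 * CP))) (periodBox M) :=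
    weightedTangentCoercive_vary_of_slicePoincare hL k hW (hskew t) hα (hΓα t) hM hskewT hperT ha (hsmall t ht) hCP hP hreg₁ hreg₂
  have hc : (0 : ℝ) ≤ 1 / (2 * (Fintype.card n : ℝ) * (1 + 4 * CP)) := by positivity
  exact coer_of_weightedTangentCoercive_vary hL k hW (hskew t) hα (hΓα t) hM hc hML hY (hperT Y hY)

/-- The Λ-UNIFORM coercivity constant of the junction: `cΛ = (1∕(2·card n·(1+4CP)))∕(1+√Λ)²`. [folklore] -/
def cLambda (n : Type*) [Fintype n] (CP Λ : ℝ) : ℝ :=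
  (1 / (2 * (Fintype.card n : ℝ) * (1 + 4 * CP))) / (1 + Real.sqrt Λ) ^ 2

omit [DecidableEq n] in
/-- `cΛ > 0` for `CP ≥ 0` and a non-empty index type. [folklore] -/
theorem cLambda_pos [Nonempty n] {CP Λ : ℝ} (hCP : 0 ≤ CP) : 0 < cLambda n CP Λ := by
  unfold cLambda
  have hcard : (0 : ℝ) < (Fintype.card n : ℝ) := by exact_mod_cast Fintype.card_pos
  have h1 : 0 < 1 + Real.sqrt Λ := by linarith [Real.sqrt_nonneg Λ]
  positivity

/-- THE LEVEL DATUM CONTROLS THE PATH FACTOR: `(1 + 24√d(e^α−1)L^k)² + 48·d·a·(L^k)² ≤ Λ` with `α, a ≥ 0` gives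
`2 + 24√d(e^α−1)L^k ≤ 1 + √Λ` and `CP·(24√d(e^α−1)L^k)² ≤ CP·(√Λ − 1)²`. [folklore] -/
theorem pathFactor_le_of_lambda {L k : ℕ} {α a Λ : ℝ} (hα : 0 ≤ α) (ha : 0 ≤ a)
    (hΛ : (1 + 24 * Real.sqrt d * (Real.exp α - 1) * (L : ℝ) ^ k) ^ 2 + 48 * d * a * ((L : ℝ) ^ k) ^ 2 ≤ Λ) :
    2 + 24 * Real.sqrt d * (Real.exp α - 1) * (L : ℝ) ^ k ≤ 1 + Real.sqrt Λ ∧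
      24 * Real.sqrt d * (Real.exp α - 1) * (L : ℝ) ^ k ≤ Real.sqrt Λ - 1 := by
  set s := 24 * Real.sqrt d * (Real.exp α - 1) * (L : ℝ) ^ k with hs
  have hδ0 : 0 ≤ Real.exp α - 1 := by linarith [Real.add_one_le_exp α]
  have hs0 : 0 ≤ s := by rw [hs]; positivity
  have h48 : 0 ≤ 48 * (d : ℝ) * a * ((L : ℝ) ^ k) ^ 2 := by positivity
  have hsq : (1 + s) ^ 2 ≤ Λ := by linarith
  have h1s : 0 ≤ 1 + s := by linarith
  have hle : 1 + s ≤ Real.sqrt Λ := by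
    rw [← Real.sqrt_sq h1s]
    exact Real.sqrt_le_sqrt hsq
  exact ⟨by linarith, by linarith⟩

/-- **`coer` FROM (P♮)_W WITH THE Λ-UNIFORM CONSTANT `cΛ`.**  As `coer_of_slicePoincare`, with the path's smallness read off
the chart's level datum `(1 + 24√d(e^α−1)L^k)² + 48·d·a·(L^k)² ≤ Λ` and the uniform hypothesis `CP·(√Λ−1)² ≤ 1∕4`:
`∀ t ∈ [0,1], ∀ Y ∈ T, cΛ·energyNormW L k W Y (periodBox M)² ≤ hess (W·e^{Γ t}) Y Y (perWin d M)`. [folklore] -/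
theorem coer_of_slicePoincare_lambda [Nonempty n] {L : ℕ} (hL : 1 ≤ L) (k : ℕ) {M : ℕ} (hM : 1 ≤ M)
    {W : Site d → Fin d → (Matrix n n ℂ)ˣ} (hW : IsUnitaryCfg W)
    {T : Set (Site d → Fin d → Matrix n n ℂ)} (hskewT : ∀ Y ∈ T, IsSkewDir Y) (hperT : ∀ Y ∈ T, IsPeriodicDir Y (M : ℤ))
    {CP : ℝ} (hCP : 0 ≤ CP) (hP : SlicePoincare L k W T CP (periodBox M))
    {Γ : ℝ → Site d → Fin d → Matrix n n ℂ} (hskew : ∀ t, IsSkewDir (Γ t))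
    {α : ℝ} (hα : 0 ≤ α) (hΓα : ∀ t (x : Site d) (μ : Fin d), ‖Γ t x μ‖ ≤ α)
    {a : ℝ} (ha : 0 ≤ a)
    (hsmall : ∀ t ∈ Icc (0:ℝ) 1, ∀ p ∈ perWin d M, ‖((fhol (vary W (Γ t) 1) p : (Matrix n n ℂ)ˣ) : Matrix n n ℂ) - 1‖ ≤ a)
    {Λ : ℝ} (hΛ : (1 + 24 * Real.sqrt d * (Real.exp α - 1) * (L : ℝ) ^ k) ^ 2 + 48 * d * a * ((L : ℝ) ^ k) ^ 2 ≤ Λ)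
    (hreg₁ : CP * (Real.sqrt Λ - 1) ^ 2 ≤ 1 / 4)
    (hreg₂ : 112 * (d : ℝ) * a * CP * ((L : ℝ) ^ k) ^ 2 ≤ 1 / (2 * (Fintype.card n : ℝ))) :
    ∀ t ∈ Icc (0:ℝ) 1, ∀ Y ∈ T,
      cLambda n CP Λ * energyNormW L k W Y (periodBox M) ^ 2 ≤ hess (vary W (Γ t) 1) Y Y (perWin d M) := by
  obtain ⟨hK, hs⟩ := pathFactor_le_of_lambda (d := d) (L := L) (k := k) hα ha hΛ
  have hδ0 : 0 ≤ Real.exp α - 1 := by linarith [Real.add_one_le_exp α]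
  have hs0 : 0 ≤ 24 * Real.sqrt d * (Real.exp α - 1) * (L : ℝ) ^ k := by positivity
  have hreg₁' : CP * (24 * Real.sqrt d * (Real.exp α - 1) * (L : ℝ) ^ k) ^ 2 ≤ 1 / 4 := by
    have hsq : (24 * Real.sqrt d * (Real.exp α - 1) * (L : ℝ) ^ k) ^ 2 ≤ (Real.sqrt Λ - 1) ^ 2 :=
      pow_le_pow_left₀ hs0 hs 2
    exact (mul_le_mul_of_nonneg_left hsq hCP).trans hreg₁
  intro t ht Y hY
  have h := coer_of_slicePoincare hL k hM hW hskewT hperT hCP hP hskew hα hΓα ha hsmall hreg₁' hreg₂ t ht Y hY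
  have hK0 : 0 < 2 + 24 * Real.sqrt d * (Real.exp α - 1) * (L : ℝ) ^ k := by linarith
  have hc0 : (0 : ℝ) ≤ 1 / (2 * (Fintype.card n : ℝ) * (1 + 4 * CP)) := by positivity
  have hE : 0 ≤ energyNormW L k W Y (periodBox M) ^ 2 := sq_nonneg _
  -- `cΛ ≤ c♮` since `2 + 24√d(e^α−1)L^k ≤ 1 + √Λ`
  have hcmp : cLambda n CP Λ ≤ (1 / (2 * (Fintype.card n : ℝ) * (1 + 4 * CP)))
      / (2 + 24 * Real.sqrt d * (Real.exp α - 1) * (L : ℝ) ^ k) ^ 2 := by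
    unfold cLambda
    refine div_le_div_of_nonneg_left hc0 (by positivity) ?_
    exact pow_le_pow_left₀ hK0.le hK 2
  exact (mul_le_mul_of_nonneg_right hcmp hE).trans h

/-! ## §3 The re-typed root T-E_w♯ from a `coer`-free chart and (P♮)_W by name (class-generic) -/

/-- Membership in the curved frame-free slice gives skewness, periodicity (period `tower L N k = L^k·N`, rewritten as `N·L^k`)
and tangency to run A's fibre (`TangentIter L (k−1)`). [folklore] -/
theorem tower_eq_mul_pow (L N : ℕ) : ∀ k : ℕ, tower L N k = N * L ^ k
  | 0 => by simp [tower]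
  | k + 1 => by
    show L * tower L N k = N * L ^ (k + 1)
    rw [tower_eq_mul_pow L N k, pow_succ]
    ring

/-- The three structural clauses of `T_♮(W)`-membership in the chart's period convention `N·L^k`. [folklore] -/
theorem mem_frameFreeBlockLandauW_struct {L N k : ℕ} {W : Site d → Fin d → (Matrix n n ℂ)ˣ}
    {Y : Site d → Fin d → Matrix n n ℂ} (hY : Y ∈ frameFreeBlockLandauW (d := d) (n := n) L N k W) :
    IsSkewDir Y ∧ IsPeriodicDir Y ((N * L ^ k : ℕ) : ℤ) ∧ TangentIter L (k - 1) W Y := by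
  obtain ⟨hsk, hper, htan, -, -⟩ := hY
  rw [tower_eq_mul_pow] at hper
  exact ⟨hsk, hper, htan⟩

/-- **THE RE-TYPED ROOT T-E_w♯ FROM A `coer`-FREE CHART AND (P♮)_W BY NAME** (class-generic; `d ≥ 1`, `L, N ≥ 1`).
If at every level `k ≥ 1`, datum `V ∈ dom` and minimiser pair `(U_A, U_B)` with `U_B` `Regular b g (k+1)`: the background
`W := cavg L U_B` is unitary and there are a `coer`-FREE chart `ChartPath` on the curved frame-free slice `T_♮(W) = frameFreeBlockLandauW L N k W`
in the norm `energyNormW L k W · (periodBox (N·L^k))` with UNIFORM `(θ, κ, θ₀)`, level data `(α, a)` with the path's sup-radius `α`,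
`(1 + 24√d(e^α−1)L^k)² + 48·d·a·(L^k)² ≤ Λ` and `112·d·a·CP·(L^k)² ≤ 1∕(2·card n)`, **the slice Poincaré shape
`SlicePoincare L k W (T_♮(W)) CP (periodBox (N·L^k))`**, and (RES♯) on `T_♮(W)` with `r = C′·residualScale d L N b g k`; and, uniformly,
`0 ≤ CP`, `CP·(√Λ−1)² ≤ 1∕4`, `0 ≤ θ₀`, `0 ≤ C′`, budget `2Λθ + Λθ² + κ ≤ cΛ∕2` — THEN
**`NE3EnergyRateWSup d 𝒞 L N b g ((1+θ₀)·(2∕cΛ)·C′) ((√Λ − 1)∕(24√d)) dom`** ((64S) `ne3EnergyRateWSup_of_chartLeaves` over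
`chartLeaves_of_chartPath` with `coer := coer_of_slicePoincare_lambda`).  (ML_w) is NO LONGER a hypothesis.  LETTERS (ruling
ρ-g24-1, disprover D-ne3r2-g10-1 (4)): the two displayed smallnesses are k-FREE and N-FREE lines on the CLASS RADIUS — (J1)
`CP·(√Λ−1)² ≤ 1∕4` with the per-pair `(1 + 24√d(e^α−1)L^k)² + … ≤ Λ` asks the chart supplier for `(e^α−1)·L^k ≤ (√Λ−1)∕(24√d)`,
where `L^k·sup‖Γ‖` is of the size of the class radius in the representative gauge (B11 (43)∕(57)∕(77) TYPE); (J2) `112·d·a·CP·(L^k)² ≤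
1∕(2·card n)` is a θ-class line on the moving configuration's plaquette radius. [folklore] -/
theorem ne3EnergyRateWSup_of_slicePoincare [Nonempty n] (hd : 1 ≤ d) {𝒞 : ℕ → Set (Site d → Fin d → (Matrix n n ℂ)ˣ)}
    {L N : ℕ} (hL : 1 ≤ L) (hN : 1 ≤ N) {b g : ℝ} {dom : Set (Site d → Fin d → (Matrix n n ℂ)ˣ)} {CP Λ θ κ θ₀ C' : ℝ}
    (hCP : 0 ≤ CP) (hreg₁ : CP * (Real.sqrt Λ - 1) ^ 2 ≤ 1 / 4) (hθ₀ : 0 ≤ θ₀) (hC' : 0 ≤ C')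
    (hbudget : 2 * Λ * θ + Λ * θ ^ 2 + κ ≤ cLambda n CP Λ / 2)
    (hchart : ∀ k : ℕ, 1 ≤ k → ∀ V ∈ dom, ∀ UA UB : Site d → Fin d → (Matrix n n ℂ)ˣ,
      IsMinimiser d 𝒞 L N k V UA → IsMinimiser d 𝒞 L N (k + 1) V UB → Regular d L N b g (k + 1) UB →
        IsUnitaryCfg (cavg L UB) ∧
        ∃ (u : Site d → (Matrix n n ℂ)ˣ) (Γ Ψ Ψ' : ℝ → Site d → Fin d → Matrix n n ℂ) (α a : ℝ), 0 ≤ α ∧ 0 ≤ a ∧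
          ChartPath 𝒞 L N k V UA UB u Γ Ψ Ψ' (frameFreeBlockLandauW L N k (cavg L UB))
            (fun Y => energyNormW L k (cavg L UB) Y (periodBox (N * L ^ k))) θ κ θ₀ a ∧
          (∀ t (x : Site d) (μ : Fin d), ‖Γ t x μ‖ ≤ α) ∧
          (1 + 24 * Real.sqrt d * (Real.exp α - 1) * (L : ℝ) ^ k) ^ 2 + 48 * d * a * ((L : ℝ) ^ k) ^ 2 ≤ Λ ∧
          112 * (d : ℝ) * a * CP * ((L : ℝ) ^ k) ^ 2 ≤ 1 / (2 * (Fintype.card n : ℝ)) ∧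
          SlicePoincare L k (cavg L UB) (frameFreeBlockLandauW L N k (cavg L UB)) CP (periodBox (N * L ^ k)) ∧
          CurlPairedResidual L k (cavg L UB) (frameFreeBlockLandauW L N k (cavg L UB))
            (C' * residualScale d L N b g k) (periodBox (N * L ^ k))) :
    NE3EnergyRateWSup d 𝒞 L N b g ((1 + θ₀) * (2 / cLambda n CP Λ) * C') ((Real.sqrt Λ - 1) / (24 * Real.sqrt d)) dom := by
  refine ne3EnergyRateWSup_of_chartLeaves hd hL hN hθ₀ (cLambda_pos (n := n) (Λ := Λ) hCP) hC' hbudget ?_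
  intro k hk V hV UA UB hA hB hreg
  obtain ⟨hW, u, Γ, Ψ, Ψ', α, a, hα, ha, hpath, hΓα, hΛw, hreg₂, hP, hres⟩ := hchart k hk V hV UA UB hA hB hreg
  have hM : 1 ≤ N * L ^ k := Nat.mul_pos (by omega) (Nat.pow_pos (by omega))
  have hskewT : ∀ Y ∈ frameFreeBlockLandauW (d := d) (n := n) L N k (cavg L UB), IsSkewDir Y :=
    fun Y hY => (mem_frameFreeBlockLandauW_struct hY).1
  have hperT : ∀ Y ∈ frameFreeBlockLandauW (d := d) (n := n) L N k (cavg L UB), IsPeriodicDir Y ((N * L ^ k : ℕ) : ℤ) :=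
    fun Y hY => (mem_frameFreeBlockLandauW_struct hY).2.1
  have hcoer := coer_of_slicePoincare_lambda hL k hM hW hskewT hperT hCP hP hpath.skew hα hΓα ha hpath.small hΛw hreg₁ hreg₂
  exact ⟨hW, u, Γ, Ψ, Ψ', _, α, a, hα, ha, chartLeaves_of_chartPath hpath hcoer, hΓα, hΛw, hres⟩

/-! ## §4 The `sfClass` specialisation: (RES♯) and the background's unitarity discharged by name -/

/-- (RES♯) ON THE CURVED FRAME-FREE SLICE, BY NAME (`d ≥ 2`, `g > 0`, levels `j+1`∕`j+2`): R♯5d's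
`curlPairedResidual_regular_residualScale` applies to `T := T_♮(cavg L U_B)` because its members are skew, `(N·L^{j+1})`-periodic and
`TangentIter L j (cavg L U_B)` by definition (K0b). [folklore] -/
theorem curlPairedResidual_frameFreeBlockLandauW [Nonempty n] (hd : 2 ≤ d) {L N : ℕ} [NeZero L] [NeZero N] (hL : 1 ≤ L)
    (hN : 1 ≤ N) (j : ℕ) {ε b g : ℝ} (hb : 0 ≤ b) (hbε : b < ε) (hg : 0 < g)
    (hsmall : LevelSmall d L (j + 1) (ε / ((L : ℝ) ^ (j + 2)) ^ 2))
    {V UB : Site d → Fin d → (Matrix n n ℂ)ˣ} (hB : IsMinimiser d (sfClass d L N ε) L N (j + 2) V UB)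
    (hreg : Regular d L N b g (j + 2) UB) :
    CurlPairedResidual L (j + 1) (cavg L UB) (frameFreeBlockLandauW L N (j + 1) (cavg L UB))
      ((Real.sqrt ((L : ℝ) ^ (d - 2))
            + (Real.sqrt ((L : ℝ) ^ (d - 2)) * Real.sqrt (8 * Fintype.card (T4AveragingDeficitWall.Plane d))
                * (128 * (d * (L : ℝ) ^ 2))
              + 2 * (2048 * ((d : ℝ) + 4) ^ 2 * (L : ℝ) ^ 2 * Real.sqrt (d * (L : ℝ) ^ d))) * b
            + b ^ 2 * (2 * (L : ℝ) ^ (d - 1) + 2 * (8 * d * (L : ℝ) ^ d)) * Real.sqrt (d / (g * (L : ℝ) ^ (d + 2))))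
        * residualScale d L N b g (j + 1))
      (periodBox (N * L ^ (j + 1))) := by
  refine curlPairedResidual_regular_residualScale hd hL hN j hb hbε hg hsmall hB hreg fun Y hY => ?_
  obtain ⟨hsk, hper, htan⟩ := mem_frameFreeBlockLandauW_struct hY
  exact ⟨hsk, hper, by simpa using htan⟩

/-- **THE RE-TYPED ROOT T-E_w♯ OVER `sfClass` FROM A `coer`-FREE CHART AND (P♮)_W BY NAME** (`d ≥ 2`, `L, N ≥ 1`, `0 ≤ b < ε`,
`g > 0`, row Y9's multi-level smallness at every level).  If at every level `j+1`, datum `V ∈ dom` and pair of minimisers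
`(U_A, U_B)` of `sfClass d L N ε` (runs `j+1`, `j+2`) with `U_B` `Regular d L N b g (j+2)` there are a `coer`-FREE chart on
`T_♮(cavg L U_B)` in the weighted norm with UNIFORM `(θ, κ, θ₀)`, level data `(α, a)` as in §3, and **`SlicePoincare L (j+1) (cavg L U_B)
(T_♮(cavg L U_B)) CP (periodBox (N·L^{j+1}))`** — THEN `NE3EnergyRateWSup d (sfClass d L N ε) L N b g ((1+θ₀)·(2∕cΛ)·C′) ((√Λ−1)∕(24√d)) dom`
with the LEVEL-FREE `C′` of R♯5d: (RES♯) by `curlPairedResidual_frameFreeBlockLandauW`, unitarity by `isUnitaryCfg_cavg_of_regular`.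
The END's hypotheses are now: (H∃)-type data of the pair, the chart L1∕L2 shape `ChartPath`, the level data, and (P♮)_W. [folklore] -/
theorem ne3EnergyRateWSup_sfClass_of_slicePoincare [Nonempty n] (hd : 2 ≤ d) {L N : ℕ} [NeZero L] [NeZero N] (hL : 1 ≤ L)
    (hN : 1 ≤ N) {ε b g : ℝ} (hb : 0 ≤ b) (hbε : b < ε) (hg : 0 < g)
    (hsmall : ∀ j : ℕ, LevelSmall d L (j + 1) (ε / ((L : ℝ) ^ (j + 2)) ^ 2))
    {dom : Set (Site d → Fin d → (Matrix n n ℂ)ˣ)} {CP Λ θ κ θ₀ : ℝ}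
    (hCP : 0 ≤ CP) (hreg₁ : CP * (Real.sqrt Λ - 1) ^ 2 ≤ 1 / 4) (hθ₀ : 0 ≤ θ₀)
    (hbudget : 2 * Λ * θ + Λ * θ ^ 2 + κ ≤ cLambda n CP Λ / 2)
    (hchart : ∀ j : ℕ, ∀ V ∈ dom, ∀ UA UB : Site d → Fin d → (Matrix n n ℂ)ˣ,
      IsMinimiser d (sfClass d L N ε) L N (j + 1) V UA → IsMinimiser d (sfClass d L N ε) L N (j + 2) V UB →
        Regular d L N b g (j + 2) UB →
        ∃ (u : Site d → (Matrix n n ℂ)ˣ) (Γ Ψ Ψ' : ℝ → Site d → Fin d → Matrix n n ℂ) (α a : ℝ), 0 ≤ α ∧ 0 ≤ a ∧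
          ChartPath (sfClass d L N ε) L N (j + 1) V UA UB u Γ Ψ Ψ' (frameFreeBlockLandauW L N (j + 1) (cavg L UB))
            (fun Y => energyNormW L (j + 1) (cavg L UB) Y (periodBox (N * L ^ (j + 1)))) θ κ θ₀ a ∧
          (∀ t (x : Site d) (μ : Fin d), ‖Γ t x μ‖ ≤ α) ∧
          (1 + 24 * Real.sqrt d * (Real.exp α - 1) * (L : ℝ) ^ (j + 1)) ^ 2 + 48 * d * a * ((L : ℝ) ^ (j + 1)) ^ 2 ≤ Λ ∧
          112 * (d : ℝ) * a * CP * ((L : ℝ) ^ (j + 1)) ^ 2 ≤ 1 / (2 * (Fintype.card n : ℝ)) ∧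
          SlicePoincare L (j + 1) (cavg L UB) (frameFreeBlockLandauW L N (j + 1) (cavg L UB)) CP
            (periodBox (N * L ^ (j + 1)))) :
    NE3EnergyRateWSup d (sfClass d L N ε) L N b g
      ((1 + θ₀) * (2 / cLambda n CP Λ)
        * (Real.sqrt ((L : ℝ) ^ (d - 2))
            + (Real.sqrt ((L : ℝ) ^ (d - 2)) * Real.sqrt (8 * Fintype.card (T4AveragingDeficitWall.Plane d))
                * (128 * (d * (L : ℝ) ^ 2))
              + 2 * (2048 * ((d : ℝ) + 4) ^ 2 * (L : ℝ) ^ 2 * Real.sqrt (d * (L : ℝ) ^ d))) * b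
            + b ^ 2 * (2 * (L : ℝ) ^ (d - 1) + 2 * (8 * d * (L : ℝ) ^ d)) * Real.sqrt (d / (g * (L : ℝ) ^ (d + 2)))))
      ((Real.sqrt Λ - 1) / (24 * Real.sqrt d)) dom := by
  have hC' : 0 ≤ Real.sqrt ((L : ℝ) ^ (d - 2))
      + (Real.sqrt ((L : ℝ) ^ (d - 2)) * Real.sqrt (8 * Fintype.card (T4AveragingDeficitWall.Plane d))
          * (128 * (d * (L : ℝ) ^ 2))
        + 2 * (2048 * ((d : ℝ) + 4) ^ 2 * (L : ℝ) ^ 2 * Real.sqrt (d * (L : ℝ) ^ d))) * b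
      + b ^ 2 * (2 * (L : ℝ) ^ (d - 1) + 2 * (8 * d * (L : ℝ) ^ d)) * Real.sqrt (d / (g * (L : ℝ) ^ (d + 2))) := by
    positivity
  refine ne3EnergyRateWSup_of_slicePoincare (by omega) hL hN hCP hreg₁ hθ₀ hC' hbudget ?_
  intro k hk V hV UA UB hA hB hreg
  obtain ⟨j, rfl⟩ : ∃ j, k = j + 1 := ⟨k - 1, by omega⟩
  have hW : IsUnitaryCfg (cavg L UB) := isUnitaryCfg_cavg_of_regular hL j hb hbε (hsmall j) hreg
  obtain ⟨u, Γ, Ψ, Ψ', α, a, hα, ha, hpath, hΓα, hΛw, hreg₂, hP⟩ := hchart j V hV UA UB hA hB hreg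
  exact ⟨hW, u, Γ, Ψ, Ψ', α, a, hα, ha, hpath, hΓα, hΛw, hreg₂, hP,
    curlPairedResidual_frameFreeBlockLandauW hd hL hN j hb hbε hg (hsmall j) hB hreg⟩

end

end Summit.QuantumFields.BalabanUV.T4Continuum.NE3EnergyRateWSupOfSlicePoincare
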